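import Summits.AtomisticToContinuum.Crystallization.Theorems.ExcessDecayLiouvilleCoarseGrainsHcpEnergySeries
import Literature.MathematicalPhysics.StatisticalMechanics.LennardJonesSquaredDistance

/-!
# Crux `ChessboardParticlePlanes.LjBilayerHcp` (stmt-AtomisticToContinuum-6710), line `Sketch`, stub N1
# `stub_hcpPowerSums` — the hcp energy per particle as two inverse-power lattice sums over `ℤ³`

With the planar form `Q(k,i,j) = i² + ij + j² + [k odd](i + j + 1/3)` of
`ExcessDecayLiouvilleCoarseGrains.hcpEnergySeries_of_eq` (so that `a² Q v + k² h²` is the squared norm of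
the site of the relaxed hexagonal close packing `hcp(a, h)` indexed by `v = (k,i,j)`), for all `a, h ≠ 0`:

* the families `v ↦ [v ≠ 0]·(a² Q v + k² h²)⁻³` and `v ↦ [v ≠ 0]·(a² Q v + k² h²)⁻⁶` are summable over `ℤ³`;
* `e(hcp a h) = (1/24) ∑_v [v ≠ 0](a² Q v + k² h²)⁻⁶ − (1/12) ∑_v [v ≠ 0](a² Q v + k² h²)⁻³`.

Proof (bookkeeping, `[folklore]`).  `hcpEnergySeries_of_eq` gives
`e(hcp a h) = ½ ∑_v [v ≠ 0] V_LJ(√(a² Q v + k² h²))` together with the summability of this family and of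
the cube family.  The form `Q` is nonnegative (`4(i² + ij + j²) = (2i + j)² + 3j²`,
`12(i² + ij + j² + i + j + 1/3) = 3(2i + j + 1)² + (3j + 1)²`), so every radicand is `≥ 0` and
`V_LJ(√s) = s⁻⁶/12 − s⁻³/6` (`lennardJones_sqrt`) termwise; the `⁻⁶` family is
`12·(LJ family) + 2·(cube family)`, hence summable, and `tsum` algebra
(`Summable.tsum_sub`, `tsum_mul_left`) concludes: `½ (S₆/12 − S₃/6) = S₆/24 − S₃/12`.
-/

noncomputable section

open Literature.MathematicalPhysics.StatisticalMechanics

namespace Summit.AtomisticToContinuum.Crystallization.Theorems.LjBilayerHcpSketch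

/-- The planar form `i² + ij + j² + [k odd](i + j + 1/3)` is nonnegative:
`4(i² + ij + j²) = (2i + j)² + 3j²` and `12(i² + ij + j² + i + j + 1/3) = 3(2i + j + 1)² + (3j + 1)²`.
[folklore] -/
theorem hcpPowerSums_form_nonneg (k : ℤ) (i j : ℝ) :
    0 ≤ i ^ 2 + i * j + j ^ 2 + (if Even k then 0 else (i + j + 1 / 3)) := by
  split_ifs
  · nlinarith [sq_nonneg (2 * i + j), sq_nonneg j]
  · nlinarith [sq_nonneg (2 * i + j + 1), sq_nonneg (3 * j + 1)]

/-- Termwise Lennard-Jones in the squared distance, with the puncture `[¬ P]`: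
`[¬P]·V_LJ(√s) = (1/12)·[¬P]·s⁻⁶ − (1/6)·[¬P]·s⁻³` for `s ≥ 0` (`lennardJones_sqrt`). [folklore] -/
theorem hcpPowerSums_term (P : Prop) [Decidable P] {s : ℝ} (hs : 0 ≤ s) :
    (if P then (0 : ℝ) else lennardJones (Real.sqrt s)) =
      (1 / 12) * (if P then (0 : ℝ) else s⁻¹ ^ 6) - (1 / 6) * (if P then (0 : ℝ) else s⁻¹ ^ 3) := by
  by_cases hP : P
  · simp [hP]
  · simp only [if_neg hP]
    exact lennardJones_sqrt hs

/-- Termwise: `[¬P]·s⁻⁶ = 12·[¬P]·V_LJ(√s) + 2·[¬P]·s⁻³` for `s ≥ 0`. [folklore] -/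
theorem hcpPowerSums_term_six (P : Prop) [Decidable P] {s : ℝ} (hs : 0 ≤ s) :
    (if P then (0 : ℝ) else s⁻¹ ^ 6) =
      12 * (if P then (0 : ℝ) else lennardJones (Real.sqrt s)) +
        2 * (if P then (0 : ℝ) else s⁻¹ ^ 3) := by
  rw [hcpPowerSums_term P hs]
  ring

/-- N1 — THE TWO POWER SERIES OF THE HCP ENERGY.  With the planar form
`Q(k,i,j) = i² + ij + j² + [k odd](i + j + 1/3)` of `hcpEnergySeries_of_eq` (so that `a² Q v + k² h²` is the
squared norm of the site `barlowPos a h alternatingHagg k i j`), for all `a, h ≠ 0` the families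
`v ↦ [v ≠ 0]·(a²Q v + k²h²)⁻³` and `v ↦ [v ≠ 0]·(a²Q v + k²h²)⁻⁶` are summable over `ℤ³` and
`e(hcp a h) = (1/24) ∑_v [v ≠ 0](a²Q v + k²h²)⁻⁶ − (1/12) ∑_v [v ≠ 0](a²Q v + k²h²)⁻³`
(`V_LJ(√s) = s⁻⁶/12 − s⁻³/6`, `lennardJones_sqrt`; the `⁻⁶` family is `12·(LJ family) + 2·(⁻³ family)`).
[folklore] -/
theorem stub_hcpPowerSums :
    ∀ (Q : ℤ × ℤ × ℤ → ℝ),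
    (Q = fun v => (v.2.1 : ℝ) ^ 2 + (v.2.1 : ℝ) * v.2.2 + (v.2.2 : ℝ) ^ 2 +
      (if Even v.1 then 0 else ((v.2.1 : ℝ) + v.2.2 + 1 / 3))) →
    ∀ (a h : ℝ) (ha : a ≠ 0) (hh : h ≠ 0),
      (Summable fun v : ℤ × ℤ × ℤ =>
        if v = 0 then (0 : ℝ) else ((a ^ 2 * Q v + (v.1 : ℝ) ^ 2 * h ^ 2)⁻¹) ^ 3) ∧
      (Summable fun v : ℤ × ℤ × ℤ =>
        if v = 0 then (0 : ℝ) else ((a ^ 2 * Q v + (v.1 : ℝ) ^ 2 * h ^ 2)⁻¹) ^ 6) ∧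
      (hcpPeriodicConfiguration ha hh).energyPerParticle lennardJones =
        (1 / 24) * (∑' v : ℤ × ℤ × ℤ,
            if v = 0 then (0 : ℝ) else ((a ^ 2 * Q v + (v.1 : ℝ) ^ 2 * h ^ 2)⁻¹) ^ 6) -
        (1 / 12) * (∑' v : ℤ × ℤ × ℤ,
            if v = 0 then (0 : ℝ) else ((a ^ 2 * Q v + (v.1 : ℝ) ^ 2 * h ^ 2)⁻¹) ^ 3) := by
  intro Q hQ a h ha hh
  obtain ⟨hS3, hSLJ, hE⟩ := ExcessDecayLiouvilleCoarseGrains.hcpEnergySeries_of_eq a h ha hh Q hQ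
  have hQv : ∀ v : ℤ × ℤ × ℤ, Q v = (v.2.1 : ℝ) ^ 2 + (v.2.1 : ℝ) * v.2.2 + (v.2.2 : ℝ) ^ 2 +
      (if Even v.1 then 0 else ((v.2.1 : ℝ) + v.2.2 + 1 / 3)) := fun v => by rw [hQ]
  /- the radicands are nonnegative -/
  have hs : ∀ v : ℤ × ℤ × ℤ, 0 ≤ a ^ 2 * Q v + (v.1 : ℝ) ^ 2 * h ^ 2 := fun v => by
    have hQ0 : 0 ≤ Q v := by
      rw [hQv]
      exact hcpPowerSums_form_nonneg v.1 _ _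
    exact add_nonneg (mul_nonneg (sq_nonneg a) hQ0) (mul_nonneg (sq_nonneg _) (sq_nonneg h))
  /- the `⁻⁶` family is `12·(LJ family) + 2·(⁻³ family)` -/
  have hS6 : Summable fun v : ℤ × ℤ × ℤ =>
      if v = 0 then (0 : ℝ) else ((a ^ 2 * Q v + (v.1 : ℝ) ^ 2 * h ^ 2)⁻¹) ^ 6 :=
    ((hSLJ.mul_left 12).add (hS3.mul_left 2)).congr fun v =>
      (hcpPowerSums_term_six (v = 0) (hs v)).symm
  refine ⟨hS3, hS6, ?_⟩
  /- the Lennard-Jones series as the combination of the two power series -/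
  have hLJ : ∑' v : ℤ × ℤ × ℤ,
      (if v = 0 then (0 : ℝ) else lennardJones (Real.sqrt (a ^ 2 * Q v + (v.1 : ℝ) ^ 2 * h ^ 2))) =
      (1 / 12) * (∑' v : ℤ × ℤ × ℤ,
          if v = 0 then (0 : ℝ) else ((a ^ 2 * Q v + (v.1 : ℝ) ^ 2 * h ^ 2)⁻¹) ^ 6) -
      (1 / 6) * (∑' v : ℤ × ℤ × ℤ,
          if v = 0 then (0 : ℝ) else ((a ^ 2 * Q v + (v.1 : ℝ) ^ 2 * h ^ 2)⁻¹) ^ 3) := by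
    rw [← tsum_mul_left, ← tsum_mul_left, ← Summable.tsum_sub (hS6.mul_left _) (hS3.mul_left _)]
    exact tsum_congr fun v => hcpPowerSums_term (v = 0) (hs v)
  rw [hE, hLJ]
  ring

end Summit.AtomisticToContinuum.Crystallization.Theorems.LjBilayerHcpSketch

end
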